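import Summits.Parity.GeneralizedHardyLittlewood.Theorems.ParityWeightedChenSwitchingParityChenInequalityTools
import Summits.Parity.GeneralizedHardyLittlewood.Theorems.ChenParityOracleBLAPParityOracleChenUpperB
import HarnessLib

/-!
# Route `ParityWeightedChenSwitching` — crux `ParityChenInequality` (stmt-Parity-18666): estimate (C)ᵘ

The UPPER sieve estimate for Chen's switched set `B(x) = {p₁p₂p₃ − 2}` (`chenSetB`) weighted by the parity
weight `u(e) = (1 − μ(e))/2`, at the FIXED level `D = x^{0.499} = x^{1/2 − 1/1000}`: for every `ε > 0` and
all large `x`,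

  `Φ₃(x) := ∑_{e ∈ B(x), e y-rough} (1 − μ(e))/2 ≤ (c e^γ/(4 · 0.998) + ε)(x/log x)V(x^{1/8}) + ½ E₂(x)`,
  `E₂(x) = ∑_{m ≤ x^{0.499}} |∑_{e ∈ B(x), m ∣ e} μ(e)|`, `c = switchingConstant`, `y = ⌈(x+3)^{1/3}⌉`

(the registered stub `stub_upperB` of the crux's birth skeleton, with `phi3`, `E2` unfolded). This is the
tree's PROVED estimate (C) `Literature.NumberTheory.Sieve.Chen.twin_sieveUpperB_holds` (Nathanson Thm 10.6
for `{p + 2}`: sieve step `roughCount_chenSetB_le`, remainder `chenRemainderExt_bound`, cardinality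
`chenTriplesExt_card_bound`) through the twisted Rosser sieve `Iwaniec1980_twisted_upper_of_half_lt` with
`b = ½ 1_B (1 − μ)`, `e = 1_B μ` — admissible because `2b + e = 1_B ≤ ã` for the enlarged switched
sequence `𝒜̃` (`indicator_chenSetB_le_chenWeightExt`), so the Möbius sums are needed on the SHARP set
`B(x)` only, exactly as in `E₂`. Verbatim the sibling route's `roughCount_chenParityB_le` /
`parity_twin_sieveUpperB` (λ-oracle) with `μ` for `λ` and the level exponent `1/2 − δ` frozen at
`δ = 1/1000` (`F(s) = 2e^γ/s` at `s = 3 · 0.499`, whence the constant `c e^γ/(4 · 0.998)`), the oracle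
remainder kept POINTWISE.

References: [Nathanson1996] Thm 10.6; [ChenSciSinica1973] p. 176; [IwaniecActaArith1980] Thm 1;
[Harman2007] §14.2.
-/

namespace Summit.Parity.GeneralizedHardyLittlewood.Theorems

open Finset Filter Topology
open scoped ArithmeticFunction.Moebius ArithmeticFunction.Omega
open Literature.NumberTheory.Sieve Literature.NumberTheory.Sieve.Chen
  Literature.NumberTheory.Sieve.ChenSieve Literature.NumberTheory.Sieve.SieveSequence

set_option maxHeartbeats 400000 in
/-- **The sieve step of (C)ᵘ** (the tree's `Chen.roughCount_chenSetB_le` with the parity weight): for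
`0 < ε ≤ 1`, `0 < δ ≤ 1/8`, `θ > 0` and all large `x`, with `y = ⌈(x+3)^{1/3}⌉`, `z = x^{1/8}`,
`∑_{e ∈ B(x), y-rough} (1 − μ(e))/2 ≤ ½((e^γ/(2(1 − 2δ)) + θ) · #T̃(x, ε) · V(z) + R(x, ε, x^{1/2−δ}))
  + ½ ∑_{d < x^{1/2−δ}, d ∣ P(y)} |∑_{b ∈ B(x), d ∣ b} μ(b)|`.
Proof: the twisted upper bound `Iwaniec1980_twisted_upper_of_half_lt` for the enlarged sequence `𝒜̃`
(`chenSeqExt`) with `b = ½ 1_B (1 − μ)`, `e = 1_B μ` (`2b + e = 1_B ≤ ã`); the main term exactly as in the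
tree (`F₁(s) = 2e^γ/s`, `V(y) ≤ V(z)(log z/log y)e^{400/log x}`, `sieve_mainTerm_algebra`). -/
theorem roughSum_chenParityMoebiusB_le {ε δ θ : ℝ} (hε : 0 < ε) (hε1 : ε ≤ 1) (hδ : 0 < δ)
    (hδ1 : δ ≤ 1 / 8) (hθ : 0 < θ) :
    ∀ᶠ x : ℕ in atTop,
      (∑ e ∈ (chenSetB x).filter (fun e => IsRough (twinY x) e), (1 - (μ e : ℝ)) / 2) ≤
        (1 / 2) * ((Real.exp Real.eulerMascheroniConstant / (2 * (1 - 2 * δ)) + θ) *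
            #(chenTriplesExt x ε) * sieveProduct 2 ((x : ℝ) ^ (1 / 8 : ℝ)) +
          chenRemainderExt x ε ((x : ℝ) ^ (1 / 2 - δ))) +
        (1 / 2) * ∑ d ∈ (Finset.range ⌈(x : ℝ) ^ (1 / 2 - δ)⌉₊).filter
            (· ∣ primesProdBelow (twinY x : ℝ)),
          |∑ b ∈ (chenSetB x).filter (fun b => d ∣ b), (μ b : ℝ)| := by
  -- Iwaniec's Theorem 1 (twisted), `κ = 1`, for the dimension class of `g = 1/φ`
  obtain ⟨B, hB, hC⟩ := Iwaniec1980_twisted_upper_of_half_lt (κ := 1) (by norm_num)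
  have hdim : HasIwaniecDimension (shiftedPrimesDensity 2) 1 (54 * Real.exp (54 / Real.log 2)) :=
    hasIwaniecDimension_shiftedPrimesDensity_two
  obtain ⟨CI, hCI⟩ := hC (54 * Real.exp (54 / Real.log 2))
  have hFeq : Set.EqOn B.1 (iwaniecUpperSieveFun 1) (Set.Ioi 0) := hB.eqOn_iwaniecSieveFun.1
  set G := Real.exp Real.eulerMascheroniConstant with hG
  have hG0 : 0 < G := Real.exp_pos _
  set K := G / (2 * (1 - 2 * δ)) with hK
  have h12δ : 0 < 1 - 2 * δ := by linarith
  have hK0 : 0 ≤ K := by positivity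
  have ha : 0 < 1 / 2 - δ := by linarith
  filter_upwards [eventually_ge_atTop 6561,
    eventually_twinY_le_rpow (show (3 : ℝ) / 8 ≤ 1 / 2 - δ by linarith),
    eventually_sieveFactor_le K (max CI 0) hθ ha] with x hx hYD hfac
  -- basic quantities
  have hxpos : 0 < x := by omega
  have hx1 : (1 : ℝ) < x := by exact_mod_cast (show 1 < x by omega)
  have hx0 : (0 : ℝ) < x := by linarith
  have hlogx : 0 < Real.log x := Real.log_pos hx1
  set zr : ℝ := (x : ℝ) ^ (1 / 8 : ℝ) with hzr
  have hzr3 : 3 ≤ zr := by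
    rw [hzr, show (3 : ℝ) = ((3 : ℝ) ^ (8 : ℕ)) ^ (1 / 8 : ℝ) by
      rw [← Real.rpow_natCast, ← Real.rpow_mul (by norm_num)]; norm_num]
    exact Real.rpow_le_rpow (by norm_num) (by exact_mod_cast hx) (by norm_num)
  have hlogzr : Real.log zr = 1 / 8 * Real.log x := Real.log_rpow hx0 _
  set Y : ℝ := (twinY x : ℝ) with hY
  have hx13 : (x : ℝ) ^ (1 / 3 : ℝ) ≤ Y := by
    calc (x : ℝ) ^ (1 / 3 : ℝ) ≤ ((x : ℝ) + 3) ^ (1 / 3 : ℝ) :=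
          Real.rpow_le_rpow hx0.le (by linarith) (by norm_num)
      _ ≤ Y := Nat.le_ceil _
  have hzY : zr ≤ Y :=
    le_trans (Real.rpow_le_rpow_of_exponent_le hx1.le (by norm_num)) hx13
  have hY2 : 2 ≤ Y := by linarith
  have hlogY : 1 / 3 * Real.log x ≤ Real.log Y := by
    have h := Real.log_le_log (Real.rpow_pos_of_pos hx0 _) hx13
    rwa [Real.log_rpow hx0] at h
  have hlogY0 : 0 < Real.log Y := by linarith [mul_pos (by norm_num : (0 : ℝ) < 1 / 3) hlogx]
  set D : ℝ := (x : ℝ) ^ (1 / 2 - δ) with hD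
  have hlogD : Real.log D = (1 / 2 - δ) * Real.log x := Real.log_rpow hx0 _
  have hlogD0 : 0 < Real.log D := by rw [hlogD]; positivity
  have hs0 : 0 < Real.log D / Real.log Y := div_pos hlogD0 hlogY0
  have hs3 : Real.log D / Real.log Y ≤ 3 := by
    rw [div_le_iff₀ hlogY0, hlogD]
    nlinarith [mul_nonneg hδ.le hlogx.le]
  -- the twisted sieve inequality for `𝒜̃`
  set A := chenSeqExt x ε with hA
  set H : ℝ := ((2 * x + 4 : ℕ) : ℝ) with hH
  have hsize : (0 : ℝ) ≤ A.size H := Nat.cast_nonneg _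
  set ind : ℕ → ℝ := fun n => if n ∈ chenSetB x then (1 : ℝ) else 0 with hind
  have hind0 : ∀ n, 0 ≤ ind n := fun n => by simp only [hind]; split_ifs <;> norm_num
  have hb : ∀ n, 0 ≤ (ind n - ind n * (μ n : ℝ)) / 2 := fun n => by
    have := mul_le_self_of_abs_le_one (hind0 n) (Literature.NumberTheory.LFunctions.abs_moebius_real_le_one n)
    linarith
  have hbe : ∀ n, 2 * ((ind n - ind n * (μ n : ℝ)) / 2) + ind n * (μ n : ℝ) ≤ A.a n := fun n => by
    have := indicator_chenSetB_le_chenWeightExt hxpos hε n (ε := ε)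
    change _ ≤ chenWeightExt x ε n
    simp only [hind] at this ⊢
    linarith
  have hI := hCI A hdim _ _ hb hbe H D Y hY2 hYD hsize
  -- identify the terms
  have hsift : ∑ n ∈ (Finset.Ioc 0 ⌊H⌋₊).filter (fun n : ℕ => n.Coprime (primesProdBelow Y)),
      (ind n - ind n * (μ n : ℝ)) / 2 =
      ∑ e ∈ (chenSetB x).filter (fun e => IsRough (twinY x) e), (1 - (μ e : ℝ)) / 2 := by
    rw [hH, hY, twistedSifted_indicator_eq_sum (chenSetB x) (chenSetB_subset_Ioc x) _ (fun n => (μ n : ℝ)),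
      Nat.ceil_natCast]
  have hE : ∀ d : ℕ, ∑ n ∈ (Finset.Ioc 0 ⌊H⌋₊).filter (d ∣ ·), ind n * (μ n : ℝ) =
      ∑ b ∈ (chenSetB x).filter (fun b => d ∣ b), (μ b : ℝ) := fun d => by
    rw [hH, twistedCongrSum_indicator_eq_sum (chenSetB x) (chenSetB_subset_Ioc x) d (fun n => (μ n : ℝ))]
  have hsizeq : A.size H = #(chenTriplesExt x ε) := rfl
  have hVq : A.densityProduct (primesProdBelow Y) = sieveProduct 2 Y :=
    densityProduct_chenSeqExt_eq x ε Y
  have hRq : ∑ d ∈ (Finset.range ⌈D⌉₊).filter (· ∣ primesProdBelow Y), |A.remainder d H| =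
      chenRemainderExt x ε D := by
    rw [hA, hH, hY]
    exact sum_abs_remainder_chenSeqExt_eq hxpos hε hε1 D
  have hFs : B.1 (Real.log D / Real.log Y) = 2 * G / (Real.log D / Real.log Y) := by
    rw [hFeq hs0, ← upperSieveFun_one, upperSieveFun_one_eq_holds ⟨hs0, hs3⟩]
  rw [hsift, hsizeq, hVq, hRq, hFs, hlogD] at hI
  simp only [hE] at hI
  -- the main term (verbatim from the tree)
  have hT0 : 0 ≤ (#(chenTriplesExt x ε) : ℝ) := Nat.cast_nonneg _
  have hVy0 : 0 ≤ sieveProduct 2 Y := (sieveProduct_two_mem_Icc Y).1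
  have hVz0 : 0 ≤ sieveProduct 2 zr := (sieveProduct_two_mem_Icc zr).1
  have hE0 : 0 ≤ Real.exp (400 / Real.log x) := (Real.exp_pos _).le
  have hρle : 1 / 8 * Real.log x / Real.log Y ≤ 3 / 8 := by
    rw [div_le_iff₀ hlogY0]
    nlinarith
  have hr0 : 0 ≤ ((1 / 2 - δ) * Real.log x) ^ (-(1 / 3 : ℝ)) := Real.rpow_nonneg (by positivity) _
  have hF0 : 0 ≤ 2 * G / ((1 / 2 - δ) * Real.log x / Real.log Y) := by positivity
  have hVyle : sieveProduct 2 Y ≤ sieveProduct 2 zr *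
      (1 / 8 * Real.log x / Real.log Y * Real.exp (400 / Real.log x)) := by
    have h := sieveProduct_two_le_mul hzr3 hzY
    rw [hlogzr] at h
    have h50 : (50 : ℝ) / (1 / 8 * Real.log x) = 400 / Real.log x := by
      rw [div_mul_eq_div_div]
      norm_num
    rwa [h50] at h
  have hρF : 1 / 8 * Real.log x / Real.log Y * (2 * G / ((1 / 2 - δ) * Real.log x / Real.log Y)) = K := by
    rw [hK]
    field_simp
    ring
  have hmain := sieve_mainTerm_algebra (C := CI) hT0 hVz0 hVy0 hE0 hρle hr0 hF0 hVyle hρF hfac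
  -- conclude
  have hhalf := mul_le_mul_of_nonneg_left hmain (by norm_num : (0 : ℝ) ≤ 1 / 2)
  have hKθ : (1 / 2) * ((K + θ) * #(chenTriplesExt x ε) * sieveProduct 2 zr + chenRemainderExt x ε D) =
      (1 / 2) * (#(chenTriplesExt x ε) * sieveProduct 2 zr * (K + θ)) + (1 / 2) * chenRemainderExt x ε D := by
    ring
  rw [hKθ]
  linarith [hI, hhalf]

set_option maxHeartbeats 400000 in
/-- **(C)ᵘ — the upper bound for the parity-weighted switched set at level `0.499`.** For every `ε₀ > 0`
and all large `x`,
`∑_{e ∈ B(x), y-rough} (1 − μ(e))/2 ≤ (c e^γ/(4 · 0.998) + ε₀)(x/log x) V(x^{1/8})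
  + ½ ∑_{m ≤ x^{0.499}} |∑_{e ∈ B(x), m ∣ e} μ(e)|`.
Proof: `roughSum_chenParityMoebiusB_le` with `δ = 1/1000` (so `x^{1/2−δ} = x^{0.499}` and
`e^γ/(2(1 − 2δ)) = e^γ/(2 · 0.998)`) and `ε = θ = t = min(1/8, ε₀/8)`; `#T̃ ≤ (1+2t)(c+t)x/log x`
(`chenTriplesExt_card_bound`), `R ≤ Cx/(log x)³ ≤ t X V` (`chenRemainderExt_bound`, `twinMainTerm_ge`), and
the oracle remainder `≤ E₂(x)` termwise (`sum_range_filter_dvd_le_sum_Icc`). -/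
theorem parityMoebius_twin_sieveUpperB :
    ∀ ε : ℝ, 0 < ε → ∀ᶠ x : ℕ in atTop,
      (∑ e ∈ (chenSetB x).filter (fun e => IsRough (twinY x) e), (1 - (μ e : ℝ)) / 2) ≤
        (switchingConstant * Real.exp Real.eulerMascheroniConstant / (4 * 0.998) + ε) * twinMainTerm x +
          (∑ m ∈ Finset.Icc 1 ⌊(x : ℝ) ^ (0.499 : ℝ)⌋₊,
            |∑ e ∈ (Literature.NumberTheory.Sieve.Chen.chenSetB x).filter (fun e => m ∣ e),
              (ArithmeticFunction.moebius e : ℝ)|) / 2 := by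
  intro ε₀ hε₀
  set G := Real.exp Real.eulerMascheroniConstant with hG
  set c := switchingConstant with hc
  have hc0 : 0 ≤ c := switchingConstant_nonneg
  have hc2 : c ≤ 2 := switchingConstant_le_two
  have hG0 : 0 < G := Real.exp_pos _
  have hG3 : G ≤ 3 := by
    have h1 : G ≤ Real.exp 1 :=
      Real.exp_le_exp.mpr (Real.eulerMascheroniConstant_lt_two_thirds.le.trans (by norm_num))
    have h2 := Real.exp_one_lt_d9
    linarith
  set K₀ := G / (2 * (1 - 2 * (1 / 1000 : ℝ))) with hK₀
  have hK₀0 : 0 ≤ K₀ := by rw [hK₀]; positivity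
  have hK₀2 : K₀ ≤ 2 := by
    rw [hK₀, div_le_iff₀ (by norm_num)]; linarith
  have hK₀c : K₀ * c / 2 = c * G / (4 * 0.998) := by
    rw [hK₀]; field_simp; norm_num; ring
  set t := min (1 / 8) (ε₀ / 8) with ht
  have ht0 : 0 < t := lt_min (by norm_num) (by positivity)
  have ht8 : t ≤ 1 / 8 := min_le_left _ _
  have ht8' : 8 * t ≤ ε₀ := by
    have := min_le_right (1 / 8 : ℝ) (ε₀ / 8)
    rw [← ht] at this
    linarith
  have ht1 : t ≤ 1 := by linarith
  have hS := roughSum_chenParityMoebiusB_le (ε := t) (δ := 1 / 1000) (θ := t) ht0 ht1 (by norm_num)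
    (by norm_num) ht0
  have hT := chenTriplesExt_card_bound t ht0 ht1 t ht0
  obtain ⟨C, hR⟩ := chenRemainderExt_bound t ht0 ht1 (1 / 1000) (by norm_num)
  have hjunk : ∀ᶠ x : ℕ in atTop, max C 0 * x / Real.log x ^ 3 ≤
      t * (16 * Real.exp (-7) * x / Real.log x ^ 2) := by
    have hpos : 0 < t * (16 * Real.exp (-7)) := by positivity
    filter_upwards [(Real.tendsto_log_atTop.comp tendsto_natCast_atTop_atTop).eventually_ge_atTop
      (max C 0 / (t * (16 * Real.exp (-7)))), eventually_gt_atTop 1] with x hx hx1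
    have hx1' : (1 : ℝ) < x := by exact_mod_cast hx1
    have hx0 : (0 : ℝ) < x := by linarith
    have hlog : 0 < Real.log x := Real.log_pos hx1'
    have hx' : max C 0 / (t * (16 * Real.exp (-7))) ≤ Real.log x := hx
    rw [div_le_iff₀ hpos] at hx'
    have hL : 0 < (x : ℝ) / Real.log x ^ 3 := by positivity
    calc max C 0 * x / Real.log x ^ 3 = max C 0 * ((x : ℝ) / Real.log x ^ 3) := by ring
      _ ≤ Real.log x * (t * (16 * Real.exp (-7))) * ((x : ℝ) / Real.log x ^ 3) :=
          mul_le_mul_of_nonneg_right hx' hL.le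
      _ = t * (16 * Real.exp (-7) * x / Real.log x ^ 2) := by
          field_simp
  filter_upwards [hS, hT, hR, hjunk, eventually_ge_atTop 6561] with x hSx hTx hRx hjx hx
  have hx1 : (1 : ℝ) < x := by exact_mod_cast (show 1 < x by omega)
  have hx0 : (0 : ℝ) < x := by linarith
  have hlog : 0 < Real.log x := Real.log_pos hx1
  have hM := twinMainTerm_ge hx
  have hM0 := twinMainTerm_nonneg x
  have hV0 : 0 ≤ sieveProduct 2 ((x : ℝ) ^ (1 / 8 : ℝ)) := (sieveProduct_two_mem_Icc _).1
  have hlev : ((1 : ℝ) / 2 - 1 / 1000) = 0.499 := by norm_num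
  rw [hlev] at hSx hRx
  set T : ℝ := (#(chenTriplesExt x t) : ℝ) with hTdef
  have hT0 : 0 ≤ T := Nat.cast_nonneg _
  set EB := ∑ m ∈ Finset.Icc 1 ⌊(x : ℝ) ^ (0.499 : ℝ)⌋₊,
    |∑ e ∈ (chenSetB x).filter (fun e => m ∣ e), (μ e : ℝ)| with hEB
  have hEB0 : 0 ≤ EB := Finset.sum_nonneg fun _ _ => abs_nonneg _
  -- `T V ≤ (1+2t)(c+t) X V`
  have h1 : T * sieveProduct 2 ((x : ℝ) ^ (1 / 8 : ℝ)) ≤ (1 + 2 * t) * (c + t) * twinMainTerm x := by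
    rw [twinMainTerm]
    calc T * sieveProduct 2 ((x : ℝ) ^ (1 / 8 : ℝ))
        ≤ ((1 + 2 * t) * (c + t) * x / Real.log x) * sieveProduct 2 ((x : ℝ) ^ (1 / 8 : ℝ)) :=
          mul_le_mul_of_nonneg_right hTx hV0
      _ = (1 + 2 * t) * (c + t) * ((x : ℝ) / Real.log x * sieveProduct 2 ((x : ℝ) ^ (1 / 8 : ℝ))) := by
          ring
  -- `R ≤ t X V`
  have h2 : chenRemainderExt x t ((x : ℝ) ^ (0.499 : ℝ)) ≤ t * twinMainTerm x := by
    have hCle : C * x / Real.log x ^ 3 ≤ max C 0 * x / Real.log x ^ 3 := by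
      have : 0 ≤ (x : ℝ) / Real.log x ^ 3 := by positivity
      calc C * x / Real.log x ^ 3 = C * ((x : ℝ) / Real.log x ^ 3) := by ring
        _ ≤ max C 0 * ((x : ℝ) / Real.log x ^ 3) := mul_le_mul_of_nonneg_right (le_max_left _ _) this
        _ = max C 0 * x / Real.log x ^ 3 := by ring
    exact hRx.trans (hCle.trans (hjx.trans (mul_le_mul_of_nonneg_left hM ht0.le)))
  -- the oracle remainder `≤ E₂(x)` termwise
  have h3 : ∑ d ∈ (Finset.range ⌈(x : ℝ) ^ (0.499 : ℝ)⌉₊).filter (· ∣ primesProdBelow (twinY x : ℝ)),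
      |∑ b ∈ (chenSetB x).filter (fun b => d ∣ b), (μ b : ℝ)| ≤ EB :=
    sum_range_filter_dvd_le_sum_Icc (fun d => abs_nonneg _) _
  -- the constant
  have hstep1 : (1 + 2 * t) * (c + t) ≤ c + 6 * t := by nlinarith
  have hstep3 : (K₀ + t) * (c + 6 * t) ≤ K₀ * c + 15 * t := by nlinarith
  have hΦ : (K₀ + t) * ((1 + 2 * t) * (c + t)) + t ≤ K₀ * c + 16 * t := by
    have hA : 0 ≤ (1 + 2 * t) * (c + t) := by positivity
    have := mul_le_mul_of_nonneg_left hstep1 (show 0 ≤ K₀ + t by positivity)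
    linarith
  have hmid : (K₀ + t) * T * sieveProduct 2 ((x : ℝ) ^ (1 / 8 : ℝ)) +
      chenRemainderExt x t ((x : ℝ) ^ (0.499 : ℝ)) ≤ (K₀ * c + 16 * t) * twinMainTerm x := by
    calc _ ≤ (K₀ + t) * ((1 + 2 * t) * (c + t) * twinMainTerm x) + t * twinMainTerm x := by
          have h4 : (K₀ + t) * T * sieveProduct 2 ((x : ℝ) ^ (1 / 8 : ℝ)) =
              (K₀ + t) * (T * sieveProduct 2 ((x : ℝ) ^ (1 / 8 : ℝ))) := by ring
          rw [h4]
          exact add_le_add (mul_le_mul_of_nonneg_left h1 (by positivity)) h2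
      _ = ((K₀ + t) * ((1 + 2 * t) * (c + t)) + t) * twinMainTerm x := by ring
      _ ≤ (K₀ * c + 16 * t) * twinMainTerm x := mul_le_mul_of_nonneg_right hΦ hM0
  change _ ≤ (c * G / (4 * 0.998) + ε₀) * twinMainTerm x + EB / 2
  calc (∑ e ∈ (chenSetB x).filter (fun e => IsRough (twinY x) e), (1 - (μ e : ℝ)) / 2)
      ≤ (1 / 2) * ((K₀ + t) * T * sieveProduct 2 ((x : ℝ) ^ (1 / 8 : ℝ)) +
          chenRemainderExt x t ((x : ℝ) ^ (0.499 : ℝ))) +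
        (1 / 2) * ∑ d ∈ (Finset.range ⌈(x : ℝ) ^ (0.499 : ℝ)⌉₊).filter
            (· ∣ primesProdBelow (twinY x : ℝ)),
          |∑ b ∈ (chenSetB x).filter (fun b => d ∣ b), (μ b : ℝ)| := hSx
    _ ≤ (1 / 2) * ((K₀ * c + 16 * t) * twinMainTerm x) + (1 / 2) * EB := by
        gcongr
    _ = (K₀ * c / 2 + 8 * t) * twinMainTerm x + EB / 2 := by ring
    _ ≤ (c * G / (4 * 0.998) + ε₀) * twinMainTerm x + EB / 2 := by
        rw [hK₀c]
        have := mul_le_mul_of_nonneg_right (show c * G / (4 * 0.998) + 8 * t ≤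
          c * G / (4 * 0.998) + ε₀ by linarith) hM0
        linarith

end Summit.Parity.GeneralizedHardyLittlewood.Theorems
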